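import Summits.Ventures.YMGap.RobustBall.BoundaryFreeEnergy
import HarnessLib

/-!
# Venture YMGap, track ROBUST-BALL — «C-DS-I» for GENERAL SHAPES: the free energy per plaquette of ANY finite region with ANY boundary field
# is `f(b)/6` up to `b·(1024√2·e^{−κ₁K} + 4·(fraction of plaquettes of depth < 4K))`, `SU(2)` on `ℤ⁴`, EVERY `0 ≤ β_W ≤ 9/25`

HONEST FRAMING. WHAT THIS IS: a venture file (cell `pub-ymgap`, track Y2 ROBUST-BALL / DS, seat ds-3, theorems only, 0 compute): the van Hove
form of `BoundaryFreeEnergy.su2_abs_log_normaliser_sub_freeEnergy_le` for ARBITRARY finite link volumes `Λ` (not only cubes). `SU(2)`, `d = 4`,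
tree coupling `0 ≤ b ≤ 9/50`; `T(Λ)` the plaquettes touching `Λ`, `(φ, m)` any depth data of `Λ` (a `1`-Lipschitz profile `φ`, positive only on
`Λ`, and depths `m_p ≤ φ` on the links of `p`), `K : ℕ` a depth budget:
* `surface_sum_le_of_depth` — `Σ_{p∈T(Λ)} min 4 (C·e^{−κ⌊m_p/4⌋}) ≤ C·e^{−κK}·#T(Λ) + 4·#{p ∈ T(Λ) : m_p < 4K}` (`κ, C ≥ 0`);
* ★★ `su2_abs_log_normaliser_div_sub_le_of_depth` — for `T(Λ) ≠ ∅` and EVERY boundary field `η`: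
  `|log Z_Λ(b|η)/#T(Λ) − f(b)/6| ≤ b·(1024√2·exp(−κ₁(R_G(2b))·K) + 4·#{p ∈ T(Λ) : m_p < 4K}/#T(Λ))`.
  Along ANY van Hove sequence `Λ_n` (for every `K` the fraction of plaquettes of depth `< 4K` tends to `0`) the free energy per plaquette with
  ARBITRARY boundary fields converges to `f(b)/6`, uniformly in the boundary fields — Dobrushin–Shlosman's Condition I in its textbook form;
* ★★ `su2_abs_kernel_energy_div_sub_le_of_depth` — the same for the mean energy per plaquette `γ_Λ^b(S_Λ|η)/#T(Λ)` against
  `Σ_{p∈T(Λ)}(2 − μ(Re tr U_p))/#T(Λ)`, `μ` any DLR state at `b` (no factor `b`).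
WHAT THIS IS NOT: lattice strong coupling; nothing continuum / Clay. Everything here is proved. [folklore]
-/

noncomputable section

open MeasureTheory ProbabilityTheory Filter Topology Real Finset Set
open scoped NNReal
open Literature.Probability.LatticeModels hiding configShift configShift_apply
open Literature.MathematicalPhysics.QuantumLattice
open Literature.MathematicalPhysics.QuantumFieldTheory (haarProbability)
open Summit.Ventures.YMGap.StarWindowGauge (gaugeR gaugeR_lt_one_of_le)
open Summit.Ventures.YMGap.StarLemmaG (gaugeR_nonneg)

namespace Summit.Ventures.YMGap.RobustBall

namespace BoundaryFreeEnergy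

/-- **Deep and shallow plaquettes**: for `0 ≤ κ`, `0 ≤ C` and any depths `m`,
`Σ_{p∈T} min 4 (C·e^{−κ⌊m_p/4⌋}) ≤ C·e^{−κK}·#T + 4·#{p ∈ T : m_p < 4K}`. [folklore] -/
theorem surface_sum_le_of_depth {κ C : ℝ} (hκ : 0 ≤ κ) (hC : 0 ≤ C) (T : Finset (ZdPlaquette 4)) (m : ZdPlaquette 4 → ℝ) (K : ℕ) :
    ∑ p ∈ T, min 4 (C * Real.exp (-(κ * ⌊m p / (4 : ℕ)⌋₊))) ≤
      C * Real.exp (-(κ * K)) * T.card + 4 * (T.filter fun p => m p < 4 * K).card := by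
  classical
  rw [← Finset.sum_filter_add_sum_filter_not T (fun p => m p < 4 * K)]
  have hsh : ∑ p ∈ T.filter (fun p => m p < 4 * K), min 4 (C * Real.exp (-(κ * ⌊m p / (4 : ℕ)⌋₊))) ≤
      4 * (T.filter fun p => m p < 4 * K).card := by
    refine (Finset.sum_le_card_nsmul _ _ 4 fun p _ => min_le_left _ _).trans ?_
    rw [nsmul_eq_mul, mul_comm]
  have hdp : ∑ p ∈ T.filter (fun p => ¬m p < 4 * K), min 4 (C * Real.exp (-(κ * ⌊m p / (4 : ℕ)⌋₊))) ≤ C * Real.exp (-(κ * K)) * T.card := by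
    refine (Finset.sum_le_card_nsmul _ _ (C * Real.exp (-(κ * K))) fun p hp => ?_).trans ?_
    · have h1 : (4 : ℝ) * K ≤ m p := not_lt.1 (Finset.mem_filter.1 hp).2
      have h2 : (K : ℝ) ≤ m p / (4 : ℕ) := by rw [le_div_iff₀ (by norm_num)]; push_cast; linarith
      have hpK : (K : ℝ) ≤ ⌊m p / (4 : ℕ)⌋₊ := by exact_mod_cast (Nat.le_floor h2)
      refine (min_le_right _ _).trans (mul_le_mul_of_nonneg_left (Real.exp_le_exp.2 ?_) hC)
      nlinarith
    · rw [nsmul_eq_mul]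
      have hc : ((T.filter (fun p => ¬m p < 4 * K)).card : ℝ) ≤ T.card := by exact_mod_cast Finset.card_filter_le _ _
      have : 0 ≤ C * Real.exp (-(κ * K)) := by positivity
      nlinarith
  linarith

/-- ★★ **«C-DS-I», VAN HOVE FORM, ARBITRARY SHAPES** (`SU(2)`, `d = 4`, tree coupling `0 ≤ b ≤ 9/50`): for every finite `Λ` with `T(Λ) ≠ ∅`,
EVERY boundary field `η`, all depth data `(φ, m)` of `Λ` and every depth budget `K`,
`|log Z_Λ(b|η)/#T(Λ) − f(b)/6| ≤ b·(1024√2·exp(−κ₁(R_G(2b))·K) + 4·#{p ∈ T(Λ) : m_p < 4K}/#T(Λ))`. [folklore] -/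
theorem su2_abs_log_normaliser_div_sub_le_of_depth {b : ℝ} (hb0 : 0 ≤ b) (hb : b ≤ 9 / 50) (Λ : Finset (ZdEdge 4))
    (hT : (plaquettesTouching Λ).Nonempty) (η : LGConfig 4 (SUN 2)) (φ : ZdEdge 4 → ℝ)
    (hφ : ∀ x y : ZdEdge 4, φ x ≤ φ y + ‖x.1 - y.1‖) (hφΛ : ∀ x, 0 < φ x → x ∈ Λ)
    (m : ZdPlaquette 4 → ℝ) (hm : ∀ p ∈ plaquettesTouching Λ, ∀ x ∈ plaquetteEdges p, m p ≤ φ x) (K : ℕ) :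
    |Real.log (∫ ζ, Real.exp (-b * wilsonBoundaryAction (fundamentalRep (Fin 2)) Λ (glueWith Λ ζ η))
          ∂(Measure.pi fun _ : ↥Λ => haarProbability (SUN 2))) / (plaquettesTouching Λ).card -
        freeEnergyDensity 4 (fundamentalRep (Fin 2)) b / 6| ≤
      b * (1024 * Real.sqrt 2 * Real.exp (-(starRate 4 (gaugeR (2 * b)) * K)) +
        4 * ((plaquettesTouching Λ).filter fun p => m p < 4 * K).card / (plaquettesTouching Λ).card) := by
  classical
  set T := plaquettesTouching Λ with hTdef
  set κ : ℝ := starRate 4 (gaugeR (2 * b)) with hκ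
  set C : ℝ := 1024 * Real.sqrt 2 with hC
  have hC0 : 0 ≤ C := by positivity
  have hκ0 : 0 ≤ κ := (starRate_pos (gaugeR_nonneg (by linarith) (by linarith)) (gaugeR_lt_one_of_le (by linarith) (by linarith))).le
  have hTpos : (0 : ℝ) < (T.card : ℝ) := by exact_mod_cast Finset.card_pos.2 hT
  have hmain := su2_abs_log_normaliser_sub_freeEnergy_le hb0 hb Λ η φ hφ hφΛ m hm
  have hS := surface_sum_le_of_depth hκ0 hC0 T m K
  rw [show Real.log (∫ ζ, Real.exp (-b * wilsonBoundaryAction (fundamentalRep (Fin 2)) Λ (glueWith Λ ζ η))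
          ∂(Measure.pi fun _ : ↥Λ => haarProbability (SUN 2))) / (T.card : ℝ) - freeEnergyDensity 4 (fundamentalRep (Fin 2)) b / 6 =
      (Real.log (∫ ζ, Real.exp (-b * wilsonBoundaryAction (fundamentalRep (Fin 2)) Λ (glueWith Λ ζ η))
          ∂(Measure.pi fun _ : ↥Λ => haarProbability (SUN 2))) - (T.card : ℝ) / 6 * freeEnergyDensity 4 (fundamentalRep (Fin 2)) b) /
        (T.card : ℝ) by field_simp, abs_div, abs_of_pos hTpos, div_le_iff₀ hTpos]
  refine hmain.trans ?_
  have e : b * (C * Real.exp (-(κ * K)) + 4 * ((T.filter fun p => m p < 4 * K).card : ℝ) / T.card) * T.card =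
      b * (C * Real.exp (-(κ * K)) * T.card + 4 * (T.filter fun p => m p < 4 * K).card) := by
    field_simp
  rw [e]
  exact mul_le_mul_of_nonneg_left hS hb0

/-- ★★ **The same for the MEAN ENERGY per plaquette** (`μ` any DLR state at `b`):
`|γ_Λ^b(S_Λ|η)/#T(Λ) − Σ_{p∈T(Λ)}(2 − μ(Re tr U_p))/#T(Λ)| ≤ 1024√2·exp(−κ₁(R_G(2b))·K) + 4·#{p ∈ T(Λ) : m_p < 4K}/#T(Λ)`. [folklore] -/
theorem su2_abs_kernel_energy_div_sub_le_of_depth {b : ℝ} (hb0 : 0 ≤ b) (hb : b ≤ 9 / 50)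
    {μ : Measure (LGConfig 4 (SUN 2))} (hμ : μ ∈ ymGibbsMeasures (d := 4) (fundamentalRep (Fin 2)) b) (Λ : Finset (ZdEdge 4))
    (hT : (plaquettesTouching Λ).Nonempty) (η : LGConfig 4 (SUN 2)) (φ : ZdEdge 4 → ℝ)
    (hφ : ∀ x y : ZdEdge 4, φ x ≤ φ y + ‖x.1 - y.1‖) (hφΛ : ∀ x, 0 < φ x → x ∈ Λ)
    (m : ZdPlaquette 4 → ℝ) (hm : ∀ p ∈ plaquettesTouching Λ, ∀ x ∈ plaquetteEdges p, m p ≤ φ x) (K : ℕ) :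
    |(∫ U, wilsonBoundaryAction (fundamentalRep (Fin 2)) Λ U ∂(ymSpecification (d := 4) (fundamentalRep (Fin 2)) b Λ η)) /
          (plaquettesTouching Λ).card -
        (∑ p ∈ plaquettesTouching Λ, ((2 : ℝ) - ∫ U, plaquetteObs (fundamentalRep (Fin 2)) p.1 p.2.1.1 p.2.1.2 U ∂μ)) /
          (plaquettesTouching Λ).card| ≤
      1024 * Real.sqrt 2 * Real.exp (-(starRate 4 (gaugeR (2 * b)) * K)) +
        4 * ((plaquettesTouching Λ).filter fun p => m p < 4 * K).card / (plaquettesTouching Λ).card := by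
  classical
  set T := plaquettesTouching Λ with hTdef
  set κ : ℝ := starRate 4 (gaugeR (2 * b)) with hκ
  set C : ℝ := 1024 * Real.sqrt 2 with hC
  have hC0 : 0 ≤ C := by positivity
  have hκ0 : 0 ≤ κ := (starRate_pos (gaugeR_nonneg (by linarith) (by linarith)) (gaugeR_lt_one_of_le (by linarith) (by linarith))).le
  have hTpos : (0 : ℝ) < (T.card : ℝ) := by exact_mod_cast Finset.card_pos.2 hT
  -- the energy theorem: kernel energy = Σ (2 − γ(W_p)), each plaquette within the boundary error of μ(W_p)
  have hmain : |(∫ U, wilsonBoundaryAction (fundamentalRep (Fin 2)) Λ U ∂(ymSpecification (d := 4) (fundamentalRep (Fin 2)) b Λ η)) -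
      ∑ p ∈ T, ((2 : ℝ) - ∫ U, plaquetteObs (fundamentalRep (Fin 2)) p.1 p.2.1.1 p.2.1.2 U ∂μ)| ≤
      ∑ p ∈ T, min 4 (C * Real.exp (-(κ * ⌊m p / (4 : ℕ)⌋₊))) := by
    rw [su2_integral_wilsonBoundaryAction_kernel, ← Finset.sum_sub_distrib]
    refine (Finset.abs_sum_le_sum_abs _ _).trans (Finset.sum_le_sum fun p hp => ?_)
    rw [show ∀ x y : ℝ, ((2 : ℝ) - x) - (2 - y) = -(x - y) from fun x y => by ring, abs_neg]
    exact su2_abs_kernel_plaquette_sub_le hb0 le_rfl hb hμ Λ η φ hφ hφΛ p (hm p hp)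
  have hS := surface_sum_le_of_depth hκ0 hC0 T m K
  rw [← sub_div, abs_div, abs_of_pos hTpos, div_le_iff₀ hTpos]
  refine hmain.trans ?_
  have e : (C * Real.exp (-(κ * K)) + 4 * ((T.filter fun p => m p < 4 * K).card : ℝ) / T.card) * T.card =
      C * Real.exp (-(κ * K)) * T.card + 4 * (T.filter fun p => m p < 4 * K).card := by
    field_simp
  rw [e]
  exact hS

end BoundaryFreeEnergy

end Summit.Ventures.YMGap.RobustBall

end
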